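import Literature.Barriers.PneNP.TSPExtensionComplexityFarkas
import HarnessLib

/-!
# Yannakakis' factorization (EF ⇒ nonnegative factorization) and the hyperplane separation bound

Support file for the extension-complexity barrier facts of
`Literature.Barriers.PneNP.TSPExtensionComplexity`, generic in the polytope. Two printed
results, both fully proved:

* `HasEFOfSize.exists_nonneg_factorisation` — the direction "`r = xc(P) ⇒ rk₊(S) ≤ r`" of
  Yannakakis' factorization theorem (Rothvoß 2017, Thm. 4 = FMPTW 2015, Thm. 3), in the form the
  lower-bound arguments consume: if `P` has an extended formulation of size `r` (slack form,
  `HasEFOfSize P r`), then for ANY family of points `v_b ∈ P` and ANY family of inequalities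
  `c_a · x ≤ d_a` valid on `P`, the slack matrix `S_ab = d_a - c_a · v_b` is a sum of `r + 1`
  nonnegative rank-one terms, `S_ab = Σ_{ℓ ∈ Option (Fin r)} U_aℓ V_ℓb` with `U, V ≥ 0`
  (`V_{·b}` = the slack vector of a lift of `v_b`, `U_{a·}` = the LP-duality multipliers of row
  `a` on the `r` sign constraints — Rothvoß's `u_i`, `v_j` — plus ONE extra coordinate `ℓ = none`
  carrying the constant `d_a - λ_aᵀg ≥ 0`, which the printed proof removes by assuming the
  inequality is tight somewhere / `dim P ≥ 1`; for lower bounds `r` versus `r + 1` is immaterial).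
* `sum_mul_mul_le_of_rectangle_bound`, `hyperplane_separation_bound`,
  `HasEFOfSize.hyperplane_separation` — Rothvoß's Lemma 5 (hyperplane separation lower bound,
  attributed to Fiorini): if `⟨W, R⟩ ≤ α` for every combinatorial rectangle `R = X × Y` and all
  slacks are `≤ s`, then `⟨W, S⟩ ≤ (r + 1) · s · α`; i.e. "`xc(P) ≥ ⟨W,S⟩ / (‖S‖_∞ · α)`" up to
  the `+1`. The proof is the printed one: a fractional rank-one matrix `x yᵀ` with
  `x ∈ [0,p]^A`, `y ∈ [0,q]^B` has `⟨W, x yᵀ⟩ ≤ p q α` (optimise the bilinear form one factor at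
  a time: an optimal `x` for fixed `y` may be taken `0/1`-valued, then likewise `y`), and each
  rank-one term of the factorization is entrywise `≤ S ≤ s`.

Sources: [Rothvoss2017] Thm. 4 (PDF p. 5), Lemma 5 (PDF p. 6); [FioriniEtAl2015] Thm. 3
(PDF p. 8).
-/

noncomputable section

namespace Literature.Barriers.PneNP

open Matrix Finset

variable {ι : Type} [Fintype ι] {r : ℕ}

/-! ### Yannakakis: extended formulation ⇒ nonnegative factorization of the slack matrix -/

/-- **Yannakakis' factorization theorem, direction EF ⇒ factorization** (Rothvoß 2017, Thm. 4;
FMPTW Thm. 3): if `P` has a slack-form extended formulation with `r` inequalities, then for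
every family of points `v_b ∈ P` and every family of valid inequalities `c_a · x ≤ d_a` the
slacks factor nonnegatively through `Option (Fin r)` (`r + 1` terms):
`d_a - c_a · v_b = Σ_ℓ U_aℓ V_ℓb`, `U, V ≥ 0`. As printed: `V_{(some j) b} = (y_b)_j`, the slack
of a lift `(v_b, y_b)` of `v_b`; `U_{a (some j)} = (λ_aᵀ F)_j`, the LP-duality multipliers
(`ExtendedFormulation.exists_multipliers`); the extra term `ℓ = none` is the constant
`d_a - λ_aᵀ g ≥ 0` times `1`. [cite: Rothvoss2017, Thm. 4 (PDF p. 5)] -/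
theorem HasEFOfSize.exists_nonneg_factorisation {P : Set (ι → ℝ)} (h : HasEFOfSize P r)
    {A B : Type*} (v : B → ι → ℝ) (hv : ∀ b, v b ∈ P) (c : A → ι → ℝ) (d : A → ℝ)
    (hvalid : ∀ a, ∀ x ∈ P, c a ⬝ᵥ x ≤ d a) :
    ∃ (U : A → Option (Fin r) → ℝ) (V : Option (Fin r) → B → ℝ),
      (∀ a l, 0 ≤ U a l) ∧ (∀ l b, 0 ≤ V l b) ∧
      ∀ a b, d a - c a ⬝ᵥ v b = ∑ l, U a l * V l b := by
  classical
  obtain ⟨Q, hQ⟩ := h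
  rcases isEmpty_or_nonempty B with hB | ⟨⟨b₀⟩⟩
  · exact ⟨fun _ _ => 0, fun _ _ => 0, fun _ _ => le_rfl, fun _ _ => le_rfl,
      fun _ b => (IsEmpty.false b).elim⟩
  have hmem : ∀ b, v b ∈ Q.projSet := fun b => by rw [hQ]; exact hv b
  have hne : Q.projSet.Nonempty := ⟨v b₀, hmem b₀⟩
  have hval' : ∀ a, ∀ x ∈ Q.projSet, c a ⬝ᵥ x ≤ d a := fun a x hx => hvalid a x (hQ ▸ hx)
  choose lam hlamE hlamF hlamg using fun a => Q.exists_multipliers hne (hval' a)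
  choose y hy0 hyeq using hmem
  refine ⟨fun a l => l.elim (d a - lam a ⬝ᵥ Q.g) fun j => (lam a ᵥ* Q.F) j,
    fun l b => l.elim 1 fun j => y b j, ?_, ?_, ?_⟩
  · intro a l
    cases l with
    | none => simpa using hlamg a
    | some j => simpa using hlamF a j
  · intro l b
    cases l with
    | none => simp
    | some j => simpa using hy0 b j
  · intro a b
    rw [Fintype.sum_option]
    simp only [Option.elim_none, Option.elim_some, mul_one]
    have h1 : ∑ j, (lam a ᵥ* Q.F) j * y b j = lam a ⬝ᵥ (Q.F *ᵥ y b) := by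
      rw [dotProduct_mulVec]; rfl
    have h2 : Q.F *ᵥ y b = Q.g - Q.E *ᵥ v b := eq_sub_of_add_eq' (hyeq b)
    rw [h1, h2, dotProduct_sub, dotProduct_mulVec, hlamE a]
    ring

/-! ### The hyperplane separation bound (Rothvoß 2017, Lemma 5) -/

/-- **Binarisation of a bilinear form** (the first half of the proof of Rothvoß's Lemma 5): if
every combinatorial rectangle `X × Y` has `Σ_{a ∈ X, b ∈ Y} W_ab ≤ α`, then for box-constrained
vectors `x ∈ [0,p]^A`, `y ∈ [0,q]^B` the fractional rank-one matrix `x yᵀ` still has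
`⟨W, x yᵀ⟩ ≤ p q α` ("if we fix `y`, this optimization problem is linear in `x` and there is
always an `x'` that is `0/1` [here: `0/p`] and also optimal; similarly `y` can be made binary").
[cite: Rothvoss2017, Lemma 5, proof (PDF p. 6)] -/
theorem sum_mul_mul_le_of_rectangle_bound {A B : Type*} [Fintype A] [Fintype B]
    [DecidableEq A] [DecidableEq B] (W : A → B → ℝ) (α : ℝ)
    (hα : ∀ (X : Finset A) (Y : Finset B), ∑ a ∈ X, ∑ b ∈ Y, W a b ≤ α)
    {p q : ℝ} (hp : 0 ≤ p) (hq : 0 ≤ q) (x : A → ℝ) (y : B → ℝ)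
    (hx0 : ∀ a, 0 ≤ x a) (hxp : ∀ a, x a ≤ p) (hy0 : ∀ b, 0 ≤ y b) (hyq : ∀ b, y b ≤ q) :
    ∑ a, ∑ b, W a b * (x a * y b) ≤ p * q * α := by
  -- step 1: for fixed `y`, replace `x` by `p · 𝟙[t_a > 0]` where `t_a = Σ_b W_ab y_b`
  set t : A → ℝ := fun a => ∑ b, W a b * y b with ht
  set X : Finset A := univ.filter fun a => 0 < t a with hX
  have h1 : ∑ a, ∑ b, W a b * (x a * y b) = ∑ a, x a * t a := by
    refine sum_congr rfl fun a _ => ?_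
    rw [ht, mul_sum]
    exact sum_congr rfl fun b _ => by ring
  have h2 : ∑ a, x a * t a ≤ p * ∑ a ∈ X, t a := by
    rw [mul_sum]
    calc ∑ a, x a * t a ≤ ∑ a, (if 0 < t a then p * t a else 0) := sum_le_sum fun a _ => by
            split_ifs with h
            · exact mul_le_mul_of_nonneg_right (hxp a) h.le
            · have := hx0 a
              nlinarith [not_lt.1 h]
      _ = ∑ a ∈ X, p * t a := by rw [hX, sum_filter]
  -- step 2: for that `0/p` vector, replace `y` by `q · 𝟙[u_b > 0]` where `u_b = Σ_{a ∈ X} W_ab`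
  set u : B → ℝ := fun b => ∑ a ∈ X, W a b with hu
  set Y : Finset B := univ.filter fun b => 0 < u b with hY
  have h3 : ∑ a ∈ X, t a = ∑ b, y b * u b := by
    simp only [ht, hu]
    rw [sum_comm]
    refine sum_congr rfl fun b _ => ?_
    rw [mul_sum]
    exact sum_congr rfl fun a _ => by ring
  have h4 : ∑ b, y b * u b ≤ q * ∑ b ∈ Y, u b := by
    rw [mul_sum]
    calc ∑ b, y b * u b ≤ ∑ b, (if 0 < u b then q * u b else 0) := sum_le_sum fun b _ => by
            split_ifs with h
            · exact mul_le_mul_of_nonneg_right (hyq b) h.le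
            · have := hy0 b
              nlinarith [not_lt.1 h]
      _ = ∑ b ∈ Y, q * u b := by rw [hY, sum_filter]
  have h5 : ∑ b ∈ Y, u b = ∑ a ∈ X, ∑ b ∈ Y, W a b := by
    simp only [hu]
    rw [sum_comm]
  calc ∑ a, ∑ b, W a b * (x a * y b) = ∑ a, x a * t a := h1
    _ ≤ p * ∑ a ∈ X, t a := h2
    _ = p * ∑ b, y b * u b := by rw [h3]
    _ ≤ p * (q * ∑ b ∈ Y, u b) := mul_le_mul_of_nonneg_left h4 hp
    _ = p * q * ∑ a ∈ X, ∑ b ∈ Y, W a b := by rw [h5]; ring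
    _ ≤ p * q * α := mul_le_mul_of_nonneg_left (hα X Y) (mul_nonneg hp hq)

/-- **Hyperplane separation bound for a nonnegative factorization** (Rothvoß 2017, Lemma 5,
matrix form): if `S_ab = Σ_{ℓ ∈ L} U_aℓ V_ℓb` with `U, V ≥ 0`, all entries `S_ab ≤ s`
(`0 ≤ s`), and `Σ_{X × Y} W ≤ α` for every rectangle, then `⟨W, S⟩ ≤ |L| · s · α` — "each
rank-one term `R_ℓ` has `‖R_ℓ‖_∞ ≤ ‖S‖_∞` and `⟨W, R_ℓ / ‖R_ℓ‖_∞⟩ ≤ α`".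
[cite: Rothvoss2017, Lemma 5 (PDF p. 6)] -/
theorem hyperplane_separation_bound {A B L : Type*} [Fintype A] [Fintype B] [Fintype L]
    [DecidableEq A] [DecidableEq B] (U : A → L → ℝ) (V : L → B → ℝ)
    (hU : ∀ a l, 0 ≤ U a l) (hV : ∀ l b, 0 ≤ V l b) {s : ℝ} (hs0 : 0 ≤ s)
    (hs : ∀ a b, ∑ l, U a l * V l b ≤ s) (W : A → B → ℝ) (α : ℝ)
    (hα : ∀ (X : Finset A) (Y : Finset B), ∑ a ∈ X, ∑ b ∈ Y, W a b ≤ α) :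
    ∑ a, ∑ b, W a b * ∑ l, U a l * V l b ≤ Fintype.card L * (s * α) := by
  have hα0 : 0 ≤ α := by simpa using hα ∅ ∅
  have hswap : ∑ a, ∑ b, W a b * ∑ l, U a l * V l b =
      ∑ l, ∑ a, ∑ b, W a b * (U a l * V l b) := by
    calc ∑ a, ∑ b, W a b * ∑ l, U a l * V l b
        = ∑ a, ∑ b, ∑ l, W a b * (U a l * V l b) := by
          refine sum_congr rfl fun a _ => sum_congr rfl fun b _ => ?_
          rw [mul_sum]
      _ = ∑ a, ∑ l, ∑ b, W a b * (U a l * V l b) := by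
          refine sum_congr rfl fun a _ => ?_
          exact sum_comm
      _ = ∑ l, ∑ a, ∑ b, W a b * (U a l * V l b) := sum_comm
  rw [hswap]
  have hl : ∀ l, ∑ a, ∑ b, W a b * (U a l * V l b) ≤ s * α := by
    intro l
    rcases isEmpty_or_nonempty A with hA | hA
    · simp only [univ_eq_empty, sum_empty]
      positivity
    rcases isEmpty_or_nonempty B with hB | hB
    · simp only [univ_eq_empty, sum_empty, sum_const_zero]
      positivity
    obtain ⟨a₀, -, ha₀⟩ := exists_max_image univ (fun a => U a l) univ_nonempty
    obtain ⟨b₀, -, hb₀⟩ := exists_max_image univ (fun b => V l b) univ_nonempty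
    have hpq : U a₀ l * V l b₀ ≤ s :=
      le_trans (single_le_sum (f := fun l' => U a₀ l' * V l' b₀)
        (fun l' _ => mul_nonneg (hU _ _) (hV _ _)) (mem_univ l)) (hs a₀ b₀)
    calc ∑ a, ∑ b, W a b * (U a l * V l b) ≤ U a₀ l * V l b₀ * α :=
          sum_mul_mul_le_of_rectangle_bound W α hα (hU a₀ l) (hV l b₀) (fun a => U a l)
            (fun b => V l b) (fun a => hU a l) (fun a => ha₀ a (mem_univ a)) (fun b => hV l b)
            (fun b => hb₀ b (mem_univ b))
      _ ≤ s * α := mul_le_mul_of_nonneg_right hpq hα0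
  calc ∑ l, ∑ a, ∑ b, W a b * (U a l * V l b) ≤ ∑ _l : L, s * α := sum_le_sum fun l _ => hl l
    _ = Fintype.card L * (s * α) := by simp [sum_const, card_univ]

/-- **Rothvoß 2017, Lemma 5 (hyperplane separation lower bound), for extended formulations**:
let `P` have a slack-form EF with `r` inequalities, let `v_b ∈ P` be points and `c_a · x ≤ d_a`
valid inequalities with all slacks `d_a - c_a · v_b ≤ s` (`0 ≤ s`), and let `W` satisfy
`Σ_{a ∈ X, b ∈ Y} W_ab ≤ α` for every rectangle `X × Y`. Then
`Σ_ab W_ab (d_a - c_a · v_b) ≤ (r + 1) · s · α` — i.e. `r + 1 ≥ ⟨W,S⟩ / (‖S‖_∞ α)`, the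
printed `xc(P) ≥ ⟨W,S⟩ / (‖S‖_∞ · α)` with the factorization's extra constant term.
[cite: Rothvoss2017, Lemma 5 (PDF p. 6) with Thm. 4 (PDF p. 5)] -/
theorem HasEFOfSize.hyperplane_separation {P : Set (ι → ℝ)} (h : HasEFOfSize P r)
    {A B : Type*} [Fintype A] [Fintype B] [DecidableEq A] [DecidableEq B]
    (v : B → ι → ℝ) (hv : ∀ b, v b ∈ P) (c : A → ι → ℝ) (d : A → ℝ)
    (hvalid : ∀ a, ∀ x ∈ P, c a ⬝ᵥ x ≤ d a) {s : ℝ} (hs0 : 0 ≤ s)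
    (hs : ∀ a b, d a - c a ⬝ᵥ v b ≤ s) (W : A → B → ℝ) (α : ℝ)
    (hα : ∀ (X : Finset A) (Y : Finset B), ∑ a ∈ X, ∑ b ∈ Y, W a b ≤ α) :
    ∑ a, ∑ b, W a b * (d a - c a ⬝ᵥ v b) ≤ (r + 1) * (s * α) := by
  obtain ⟨U, V, hU, hV, hS⟩ := h.exists_nonneg_factorisation v hv c d hvalid
  have hS' : ∀ a b, ∑ l, U a l * V l b ≤ s := fun a b => hS a b ▸ hs a b
  have := hyperplane_separation_bound U V hU hV hs0 hS' W α hα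
  simp only [Fintype.card_option, Fintype.card_fin, Nat.cast_add, Nat.cast_one] at this
  calc ∑ a, ∑ b, W a b * (d a - c a ⬝ᵥ v b) = ∑ a, ∑ b, W a b * ∑ l, U a l * V l b := by
        simp only [hS]
    _ ≤ (r + 1) * (s * α) := this

end Literature.Barriers.PneNP

end
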